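/-
Copyright: the b2b-balaban cell (near-miss cell 7), T⁴-continuum fan-out; row NE7b ROUND-2 swarm, seat
t4-ne7b-formalise-leaf-10 (gen 3; rows S6g′(f) + S1c of `t4/b2b-balaban-t4-ne7b-p1/LEAVES-NE7b.md`, owner's rulings
R-OWNER-22-12 (2), 22-18, 22-19, 22-20).  Released under the licence of the surrounding project.
-/
import Summits.QuantumFields.BalabanUV.T4Continuum.Support.HistorySiblingEntropyListing

/-!
# Sibling entropy bound — THE SORTED TWIN OF A PEDIGREE: `P.sortR` lists every component's younger parts in
# recorded-shape order; recorded shapes, root steps, `HeadOldest`, `RenewDated` are unchanged; so the END holds for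
# `P.sortR.gen c` under the EXISTING reading conventions only (rows S6g′(f) × S1c, file 1′)

Summits-side support leaf of the T⁴-continuum cell (rung (B)+1 on a FINITE torus only; NOT infinite volume, NOT the
mass gap, NOT the Clay statement; NOT a proof of the spine estimate NE7b).  Row NE7b, route «COUNT»; sequel of
`HistorySiblingEntropyListing`.  [folklore] well-founded recursion over the pedigree's steps and list sorting; nothing
is quoted from print, nothing printed is asserted, no `[cite:]` tag, no `Prop` fact minted.

WHY.  `HistoryRealise.Realises` realises a pedigree along PREFIX-contact chains, i.e. in the geometric order in which H3
writes a cluster's parts; the entropy END (`ENT_leR_gen`) wants the younger parts in RECORDED-SHAPE order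
(`TailSortedR`).  Rather than re-deriving the realisation theory for an order-free clause, keep the realised pedigree
`P` as H3 writes it and COUNT its sorted twin `P.sortR`: same steps, same parts, each tail merge-sorted by the key
`enc ∘ toShapeR ∘ flatPart`.  Because `toShapeR` itself sorts the non-host shapes, the recorded shape of every
component is the SAME for `P` and `P.sortR` (`toShapeR_gen_sortR`), hence so are root steps; `HeadOldest` and
`RenewDated` transfer, `TailSortedR` holds for `P.sortR` by construction, and the END follows for `P.sortR.gen c` from
`HeadOldest P` + `RenewDated P` alone — both already fields of the H3 reading (`RealisedDomains.headOldest`∕`renew_step`).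

WHAT.  `Pedigree.flatPart`, `gmap_partGen`, `keyR`, `sortTail`, **`Pedigree.sortR`**, `parts_sortR_perm`;
`sortS_eq_of_perm`, `toShapeR_chain'`; **`toShapeR_gen_sortR : toShapeR (P.sortR.gen c) = toShapeR (P.gen c)`**,
`rootStep_gen_sortR`, **`headOldest_sortR`**, **`renewDated_sortR`**, **`tailSortedR_sortR`**, and the END
**`ENT_leR_sortR : (∀ c, P.HeadOldest c) → P.RenewDated → ENT PEv.step (P.sortR.gen c) ≤ 2·bsum (1 + fat) (P.sortR.gen c)
+ 4·partnerAges + 8·mrg + 8·NR`** (all of `P.sortR.gen c`).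

HONEST SCOPE.  The member counted is the sorted twin's flat genealogy; its per-part geometric data (zones, contact
forest) are the realised pedigree's, carried along the permutation `parts_sortR_perm` by the instance — not here.  An
intrinsically order-free realisation clause (`RealisesC`, R-OWNER-22-18) is NOT provided by this file.  NE7b NOT proved.
HONEST DEPENDENCY (cell): continuum YM on T⁴ ⇐ BetaPertH ∧ nine spine estimates (0/9 proved); BetaPertH ⇐ (D1) ∧
(D4) ∧ CAP+tail; G-an2-4 gates asym, D1 and NE2/3/4.  This file changes none of it.
-/

open Finset
open Literature.MathematicalPhysics.QuantumFieldTheory.Balaban1983to89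
open T4PersistenceDictionary T4PartnerMultiplicity T4BranchingRecordsGas
open Summit.QuantumFields.BalabanUV.T4Continuum.ZoneSkeleton
open Summit.QuantumFields.BalabanUV.T4Continuum.HistorySiblingEntropyBound
open Summit.QuantumFields.BalabanUV.T4Continuum.HistoryGen
open Summit.QuantumFields.BalabanUV.T4Continuum.HistoryJoins
open Summit.QuantumFields.BalabanUV.T4Continuum.HistoryJoinsAdm
open Summit.QuantumFields.BalabanUV.T4Continuum.HistoryJoinsBudget (mrg)
open Summit.QuantumFields.BalabanUV.T4Continuum.HistoryJoinsEntropyBudget (ENT)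

noncomputable section

open scoped Classical

namespace Summit.QuantumFields.BalabanUV.T4Continuum.HistoryGen.Pedigree

open HistorySiblingEntropyBridge

variable {α π : Type*} (P : Pedigree α π)

/-- the flat genealogy of a part of `c` (tags forgotten) [folklore] -/
def flatPart (c : α) : Part α π → Gen PEv
  | Part.new d _ => Gen.born ((P.step c, 0, d) : PEv) (P.step c)
  | Part.old c' false => P.gen c'
  | Part.old c' true => Gen.renew (P.gen c') ((P.step c, 1, 0) : PEv) (P.step c')

/-- the tagged part genealogy flattens to `flatPart` [folklore] -/
theorem gmap_partGen (c : α) (i : ℕ) (q : Part α π) : gmap Prod.fst (P.partGen c P.genT i q) = P.flatPart c q := by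
  rcases q with ⟨c', _ | _⟩ | ⟨d, x⟩ <;> rfl

/-- the sort key of a part: the code of its recorded shape [folklore] -/
def keyR (c : α) (q : Part α π) : ℕ := enc (toShapeR PEv.step PEv.fat (P.flatPart c q))

/-- the part list with its tail merge-sorted by `keyR` (head kept first) [folklore] -/
def sortTail (c : α) : List (Part α π) → List (Part α π)
  | [] => []
  | p :: ps => p :: ps.mergeSort fun q q' => decide (P.keyR c q ≤ P.keyR c q')

/-- sorting the tail keeps the members [folklore] -/
theorem mem_sortTail {c : α} {q : Part α π} : ∀ {l : List (Part α π)}, q ∈ P.sortTail c l ↔ q ∈ l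
  | [] => Iff.rfl
  | p :: ps => by
      simp only [sortTail, List.mem_cons]
      rw [(List.mergeSort_perm ps _).mem_iff]

/-- **THE SORTED TWIN** of a pedigree: same steps, every tail in recorded-shape order. [folklore] -/
def sortR : Pedigree α π where
  step := P.step
  parts c := P.sortTail c (P.parts c)
  step_lt c c' r h := P.step_lt c c' r (P.mem_sortTail.1 h)

/-- steps are unchanged [folklore] -/
@[simp] theorem step_sortR (c : α) : P.sortR.step c = P.step c := rfl

/-- parts are unchanged up to order [folklore] -/
theorem parts_sortR_perm (c : α) : (P.sortR.parts c).Perm (P.parts c) := by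
  show (P.sortTail c (P.parts c)).Perm (P.parts c)
  cases P.parts c with
  | nil => exact List.Perm.refl _
  | cons p ps => exact (List.mergeSort_perm ps _).cons p

/-- membership of parts is unchanged [folklore] -/
theorem mem_parts_sortR {c : α} {q : Part α π} : q ∈ P.sortR.parts c ↔ q ∈ P.parts c := (P.parts_sortR_perm c).mem_iff

/-- the parts of the sorted twin, unfolded on a non-empty part list [folklore] -/
theorem parts_sortR_of_cons {c : α} {p : Part α π} {ps : List (Part α π)} (h : P.parts c = p :: ps) :
    P.sortR.parts c = p :: ps.mergeSort fun q q' => decide (P.keyR c q ≤ P.keyR c q') := by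
  show P.sortTail c (P.parts c) = _
  rw [h]; rfl

/-- the parts of the sorted twin, unfolded on an empty part list [folklore] -/
theorem parts_sortR_of_nil {c : α} (h : P.parts c = []) : P.sortR.parts c = [] := by
  show P.sortTail c (P.parts c) = _
  rw [h]; rfl

/-- a listed part's genealogy is among the part genealogies [folklore] -/
theorem partGen_mem_partsGenAux (c : α) (rec : α → Gen (Lab α π)) :
    ∀ (i : ℕ) (ps : List (Part α π)) (q : Part α π), q ∈ ps → ∃ k, P.partGen c rec (i + k) q ∈ P.partsGenAux c rec i ps
  | i, [], q, h => by simp at h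
  | i, p :: ps, q, h => by
      rcases List.mem_cons.1 h with rfl | h
      · exact ⟨0, by simp⟩
      · obtain ⟨k, hk⟩ := partGen_mem_partsGenAux c rec (i + 1) ps q h
        refine ⟨k + 1, ?_⟩
        rw [partsGenAux_cons, show i + (k + 1) = i + 1 + k by omega]
        exact List.mem_cons_of_mem _ hk

/-- the part genealogies flatten to the flat parts, in order [folklore] -/
theorem map_gmap_partsGenAux (c : α) : ∀ (i : ℕ) (ps : List (Part α π)),
    (P.partsGenAux c P.genT i ps).map (gmap Prod.fst) = ps.map (P.flatPart c)
  | i, [] => by simp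
  | i, p :: ps => by rw [partsGenAux_cons, List.map_cons, List.map_cons, P.gmap_partGen, map_gmap_partsGenAux c _ ps]

/-- root steps of flat parts are those of the tagged part genealogies [folklore] -/
theorem rootStep_flatPart (c : α) (i : ℕ) (q : Part α π) :
    (P.flatPart c q).rootStep = (P.partGen c P.genT i q).rootStep := by
  rw [← P.gmap_partGen c i q, rootStep_gmap]

/-- «oldest line first», read on the flat parts [folklore] -/
theorem headOldest_flat {c : α} (hH : P.HeadOldest c) {p : Part α π} {ps : List (Part α π)} (hps : P.parts c = p :: ps) :
    (∀ q ∈ ps, (P.flatPart c p).rootStep ≤ (P.flatPart c q).rootStep) ∧ (ps ≠ [] → (P.flatPart c p).rootStep < P.step c) := by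
  have h := hH (P.partGen c P.genT 0 p) (P.partsGenAux c P.genT (0 + 1) ps)
    (by unfold partsGen; rw [hps, partsGenAux_cons])
  refine ⟨fun q hq => ?_, fun hne => ?_⟩
  · obtain ⟨k, hk⟩ := P.partGen_mem_partsGenAux c P.genT (0 + 1) ps q hq
    rw [P.rootStep_flatPart c 0 p, P.rootStep_flatPart c (0 + 1 + k) q]
    exact h.1 _ hk
  · rw [P.rootStep_flatPart c 0 p]
    refine h.2 fun h0 => hne ?_
    obtain ⟨q, qs, rfl⟩ := List.exists_cons_of_ne_nil hne
    simp at h0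

end Summit.QuantumFields.BalabanUV.T4Continuum.HistoryGen.Pedigree

namespace Summit.QuantumFields.BalabanUV.T4Continuum.HistorySiblingEntropyBridge

/-! ## §1 Two list facts -/

/-- permuted shape lists have the same canonical sort [folklore] -/
theorem sortS_eq_of_perm {l l' : List Shape} (h : l.Perm l') : sortS l = sortS l' :=
  List.Perm.eq_of_pairwise (fun _ _ _ _ hab hba => enc_injective (le_antisymm hab hba)) (sortS_pairwise l)
    (sortS_pairwise l') (((sortS_perm l).trans h).trans (sortS_perm l').symm)

/-- the recorded shape of a head-oldest chain of closed members (tail in any order) [folklore] -/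
theorem toShapeR_chain' {s : ℕ} {q₀ : Gen PEv} {qs : List (Gen PEv)} {X Y : Gen PEv}
    (hG : chainMerge q₀ qs (merL s) = Gen.merge X Y ((s, 2, 0) : PEv)) (hc₀ : clusterParts PEv.step s q₀ = [([], q₀)])
    (hc : ∀ q ∈ qs, clusterParts PEv.step s q = [([], q)]) (hold : ∀ q ∈ qs, q₀.rootStep ≤ q.rootStep) :
    toShapeR PEv.step PEv.fat (chainMerge q₀ qs (merL s)) =
      .join (2 * s + 2) (toShapeR PEv.step PEv.fat q₀) (ofList (sortS (qs.map (toShapeR PEv.step PEv.fat)))) := by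
  have hl : PEv.step ((s, 2, 0) : PEv) = s := rfl
  obtain ⟨h0, hh, hpart⟩ := part_hostIdx_chain hl hG hc₀ hold
  rw [hG, toShapeR_merge, hh, hpart, map_nonhost_chain hl hG hc₀ hc hold]
  rfl

/-- the recorded shape of a chain with head `q₀` and tail `qs` (possibly empty), closed members, head oldest
[folklore] -/
theorem toShapeR_chain_eq {s : ℕ} (q₀ : Gen PEv) (qs : List (Gen PEv)) (hc₀ : clusterParts PEv.step s q₀ = [([], q₀)])
    (hc : ∀ q ∈ qs, clusterParts PEv.step s q = [([], q)]) (hold : ∀ q ∈ qs, q₀.rootStep ≤ q.rootStep) :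
    toShapeR PEv.step PEv.fat (chainMerge q₀ qs (merL s)) =
      if qs = [] then toShapeR PEv.step PEv.fat q₀ else
        .join (2 * s + 2) (toShapeR PEv.step PEv.fat q₀) (ofList (sortS (qs.map (toShapeR PEv.step PEv.fat)))) := by
  by_cases hqs : qs = []
  · subst hqs; simp
  · obtain ⟨X, Y, hXY⟩ := exists_chainMerge_eq_merge ((s, 2, 0) : PEv) q₀ qs hqs
    rw [if_neg hqs, toShapeR_chain' hXY hc₀ hc hold]

/-! ## §2 The recorded shape is unchanged by sorting the tails -/

variable {α π : Type*} (P : Pedigree α π)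

/-- the flat genealogy of a component with no part [folklore] -/
theorem gen_eq_of_nil (Q : Pedigree α π) {c : α} (h : Q.parts c = []) :
    Q.gen c = Gen.born ((Q.step c, 0, 0) : PEv) (Q.step c) := by
  rw [gen_eq_gmap_join]
  unfold Pedigree.partsGen
  rw [h]
  simp [Pedigree.join, gmap]

/-- the flat genealogy of a component as the chain of its flat parts [folklore] -/
theorem gen_eq_of_cons (Q : Pedigree α π) {c : α} {p : Part α π} {ps : List (Part α π)} (h : Q.parts c = p :: ps) :
    Q.gen c = chainMerge (Q.flatPart c p) (ps.map (Q.flatPart c)) (merL (Q.step c)) := by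
  rw [gen_eq_gmap_join]
  unfold Pedigree.partsGen
  rw [h, Pedigree.partsGenAux_cons]
  simp only [Pedigree.join]
  rw [gmap_chainMerge, fst_comp_merLab, Q.gmap_partGen, Q.map_gmap_partsGenAux]

/-- flat parts are closed at the step of their component [folklore] -/
theorem closed_flatPart (Q : Pedigree α π) (c : α) (q : Part α π) (hq : q ∈ Q.parts c) :
    clusterParts PEv.step (Q.step c) (Q.flatPart c q) = [([], Q.flatPart c q)] := by
  rcases q with ⟨c', _ | _⟩ | ⟨d, x⟩
  · exact closed_gen Q c' (Q.step_lt c c' false hq)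
  · simp [Pedigree.flatPart]
  · simp [Pedigree.flatPart]

/-- equal recorded shapes have equal root steps [folklore] -/
theorem rootStep_eq_of_toShapeR_eq {ε : Type*} {st fat : ε → ℕ} {G G' : Gen ε}
    (h : toShapeR st fat G = toShapeR st fat G') : G.rootStep = G'.rootStep := by
  have := congrArg Shape.root h
  rw [toShapeR_root, toShapeR_root] at this
  omega

/-- the recorded shape of a component's flat genealogy from its part list [folklore] -/
theorem toShapeR_gen_eq (Q : Pedigree α π) {c : α} (hH : Q.HeadOldest c) {p : Part α π} {ps : List (Part α π)}
    (h : Q.parts c = p :: ps) :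
    toShapeR PEv.step PEv.fat (Q.gen c) =
      if ps = [] then toShapeR PEv.step PEv.fat (Q.flatPart c p) else
        .join (2 * Q.step c + 2) (toShapeR PEv.step PEv.fat (Q.flatPart c p))
          (ofList (sortS ((ps.map (Q.flatPart c)).map (toShapeR PEv.step PEv.fat)))) := by
  rw [gen_eq_of_cons Q h, toShapeR_chain_eq _ _ (closed_flatPart Q c p (by rw [h]; exact List.mem_cons_self))
    (fun q hq => by
      obtain ⟨q', hq', rfl⟩ := List.mem_map.1 hq
      exact closed_flatPart Q c q' (by rw [h]; exact List.mem_cons_of_mem _ hq'))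
    (fun q hq => by
      obtain ⟨q', hq', rfl⟩ := List.mem_map.1 hq
      exact (Q.headOldest_flat hH h).1 q' hq')]
  simp only [List.map_eq_nil_iff]

/-- **SORTING THE TAILS DOES NOT CHANGE THE RECORDED SHAPE** of any component. [folklore] -/
theorem toShapeR_gen_sortR (hH : ∀ c, P.HeadOldest c) (c : α) :
    toShapeR PEv.step PEv.fat (P.sortR.gen c) = toShapeR PEv.step PEv.fat (P.gen c) := by
  -- the parts' recorded shapes agree (older components by induction)
  have hpart : ∀ q ∈ P.parts c,
      toShapeR PEv.step PEv.fat (P.sortR.flatPart c q) = toShapeR PEv.step PEv.fat (P.flatPart c q) := by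
    intro q hq
    rcases q with ⟨c', _ | _⟩ | ⟨d, x⟩
    · have hlt := P.step_lt c c' false hq
      exact toShapeR_gen_sortR hH c'
    · have hlt := P.step_lt c c' true hq
      simp only [Pedigree.flatPart, Pedigree.step_sortR, toShapeR_renew]
      rw [toShapeR_gen_sortR hH c']
    · rfl
  -- «oldest line first» for the sorted twin at `c`, from the equal root steps
  have hHS : P.sortR.HeadOldest c := by
    intro G Gs hG
    cases hps : P.parts c with
    | nil =>
        unfold Pedigree.partsGen at hG
        rw [P.parts_sortR_of_nil hps] at hG
        simp at hG
    | cons p ps =>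
        have hPS := P.parts_sortR_of_cons hps
        unfold Pedigree.partsGen at hG
        rw [hPS, Pedigree.partsGenAux_cons, List.cons.injEq] at hG
        obtain ⟨rfl, rfl⟩ := hG
        have hflat := P.headOldest_flat (hH c) hps
        have hperm := List.mergeSort_perm ps fun q q' => decide (P.keyR c q ≤ P.keyR c q')
        have hrt : ∀ q ∈ P.parts c, (P.sortR.flatPart c q).rootStep = (P.flatPart c q).rootStep := fun q hq =>
          rootStep_eq_of_toShapeR_eq (hpart q hq)
        have hp : p ∈ P.parts c := by rw [hps]; exact List.mem_cons_self
        refine ⟨fun H hHm => ?_, fun hne => ?_⟩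
        · obtain ⟨k, q, hq, rfl⟩ := P.sortR.mem_partsGenAux hHm
          have hq' : q ∈ ps := hperm.mem_iff.1 hq
          rw [← P.sortR.rootStep_flatPart c, ← P.sortR.rootStep_flatPart c, hrt p hp,
            hrt q (by rw [hps]; exact List.mem_cons_of_mem _ hq')]
          exact hflat.1 q hq'
        · rw [← P.sortR.rootStep_flatPart c, hrt p hp, Pedigree.step_sortR]
          refine hflat.2 fun h0 => hne ?_
          subst h0
          simp
  cases hps : P.parts c with
  | nil => rw [gen_eq_of_nil P hps, gen_eq_of_nil P.sortR (P.parts_sortR_of_nil hps)]; rfl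
  | cons p ps =>
      have hPS := P.parts_sortR_of_cons hps
      set ps' := ps.mergeSort fun q q' => decide (P.keyR c q ≤ P.keyR c q') with hps'
      have hperm : ps'.Perm ps := List.mergeSort_perm ps _
      rw [toShapeR_gen_eq P (hH c) hps, toShapeR_gen_eq P.sortR hHS hPS]
      have hp : p ∈ P.parts c := by rw [hps]; exact List.mem_cons_self
      have hnil : (ps' = []) = (ps = []) := by
        rw [← List.length_eq_zero_iff, ← List.length_eq_zero_iff, hperm.length_eq]
      have hl : (ps'.map (P.sortR.flatPart c)).map (toShapeR PEv.step PEv.fat) =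
          ps'.map fun q => toShapeR PEv.step PEv.fat (P.flatPart c q) := by
        rw [List.map_map]
        exact List.map_congr_left fun q hq => hpart q (by rw [hps]; exact List.mem_cons_of_mem _ (hperm.mem_iff.1 hq))
      have hsort : sortS ((ps'.map (P.sortR.flatPart c)).map (toShapeR PEv.step PEv.fat)) =
          sortS ((ps.map (P.flatPart c)).map (toShapeR PEv.step PEv.fat)) := by
        rw [hl, List.map_map]
        exact sortS_eq_of_perm (hperm.map _)
      simp only [Pedigree.step_sortR, hpart p hp, hsort, hnil]
termination_by P.step c
decreasing_by all_goals exact hlt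

/-- flat parts of the sorted twin have the same recorded shapes [folklore] -/
theorem toShapeR_flatPart_sortR (hH : ∀ c, P.HeadOldest c) (c : α) (q : Part α π) :
    toShapeR PEv.step PEv.fat (P.sortR.flatPart c q) = toShapeR PEv.step PEv.fat (P.flatPart c q) := by
  rcases q with ⟨c', _ | _⟩ | ⟨d, x⟩
  · exact toShapeR_gen_sortR P hH c'
  · simp only [Pedigree.flatPart, Pedigree.step_sortR, toShapeR_renew]; rw [toShapeR_gen_sortR P hH c']
  · rfl

/-- … and the same root steps [folklore] -/
theorem rootStep_flatPart_sortR (hH : ∀ c, P.HeadOldest c) (c : α) (q : Part α π) :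
    (P.sortR.flatPart c q).rootStep = (P.flatPart c q).rootStep :=
  rootStep_eq_of_toShapeR_eq (toShapeR_flatPart_sortR P hH c q)

/-! ## §3 The conventions for the sorted twin, and the END -/

/-- **«OLDEST LINE FIRST» TRANSFERS** to the sorted twin. [folklore] -/
theorem headOldest_sortR (hH : ∀ c, P.HeadOldest c) (c : α) : P.sortR.HeadOldest c := by
  intro G Gs hG
  cases hps : P.parts c with
  | nil =>
      unfold Pedigree.partsGen at hG
      rw [P.parts_sortR_of_nil hps] at hG
      simp at hG
  | cons p ps =>
      have hPS := P.parts_sortR_of_cons hps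
      unfold Pedigree.partsGen at hG
      rw [hPS, Pedigree.partsGenAux_cons, List.cons.injEq] at hG
      obtain ⟨rfl, rfl⟩ := hG
      have hflat := P.headOldest_flat (hH c) hps
      have hperm := List.mergeSort_perm ps fun q q' => decide (P.keyR c q ≤ P.keyR c q')
      refine ⟨fun H hHm => ?_, fun hne => ?_⟩
      · obtain ⟨k, q, hq, rfl⟩ := P.sortR.mem_partsGenAux hHm
        rw [← P.sortR.rootStep_flatPart c, ← P.sortR.rootStep_flatPart c, rootStep_flatPart_sortR P hH,
          rootStep_flatPart_sortR P hH]
        exact hflat.1 q (hperm.mem_iff.1 hq)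
      · rw [← P.sortR.rootStep_flatPart c, rootStep_flatPart_sortR P hH, Pedigree.step_sortR]
        refine hflat.2 fun h0 => hne ?_
        subst h0
        simp

/-- **RENEWAL DATING TRANSFERS** to the sorted twin. [folklore] -/
theorem renewDated_sortR (hR : P.RenewDated) : P.sortR.RenewDated := fun c c' h =>
  hR c c' (P.mem_parts_sortR.1 h)

/-- **THE SORTED TWIN LISTS ITS TAILS IN RECORDED-SHAPE ORDER.** [folklore] -/
theorem tailSortedR_sortR (hH : ∀ c, P.HeadOldest c) (c : α) : P.sortR.TailSortedR c := by
  intro G Gs hG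
  cases hps : P.parts c with
  | nil =>
      unfold Pedigree.partsGen at hG
      rw [P.parts_sortR_of_nil hps] at hG
      simp at hG
  | cons p ps =>
      have hPS := P.parts_sortR_of_cons hps
      unfold Pedigree.partsGen at hG
      rw [hPS, Pedigree.partsGenAux_cons, List.cons.injEq] at hG
      obtain ⟨rfl, rfl⟩ := hG
      rw [P.sortR.map_gmap_partsGenAux, List.map_map]
      have hsorted := List.pairwise_mergeSort (le := fun q q' => decide (P.keyR c q ≤ P.keyR c q'))
        (fun a b c' hab hbc => by simp only [decide_eq_true_eq] at hab hbc ⊢; exact hab.trans hbc)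
        (fun a b => by simp only [Bool.or_eq_true, decide_eq_true_eq]; exact le_total _ _) ps
      rw [List.pairwise_map]
      refine hsorted.imp fun {a b} hab => ?_
      simp only [decide_eq_true_eq, Pedigree.keyR] at hab
      simp only [Function.comp, toShapeR_flatPart_sortR P hH]
      exact hab

/-- **THE END FOR THE SORTED TWIN — under the EXISTING reading conventions only**: `HeadOldest` and `RenewDated` of
the realised pedigree `P` give, for every component `c`,
`ENT PEv.step (P.sortR.gen c) ≤ 2·bsum (1 + fat) (P.sortR.gen c) + 4·partnerAges + 8·mrg + 8·NR` (of `P.sortR.gen c`).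
[folklore] -/
theorem ENT_leR_sortR [DecidableEq α] [DecidableEq π] (hH : ∀ c, P.HeadOldest c) (hR : P.RenewDated) (c : α) :
    ENT PEv.step (P.sortR.gen c) ≤
      2 * bsum (fun b => (1 : ℝ) + PEv.fat b) (P.sortR.gen c) + 4 * (partnerAges PEv.step (P.sortR.gen c) : ℝ) +
        8 * mrg PEv.step (P.sortR.gen c) + 8 * (NR PEv.step (P.sortR.gen c) : ℝ) :=
  ENT_leR_gen P.sortR (headOldest_sortR P hH) (tailSortedR_sortR P hH) (renewDated_sortR P hR) c

end Summit.QuantumFields.BalabanUV.T4Continuum.HistorySiblingEntropyBridge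

end
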